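import Summits.CriticalPhenomena.PercolationContinuityZ3.Theorems.PercNearOneGluingNoHeavyLowerTailSahiThreeCopyCellTransport

/-!
# `NoHeavyLowerTail` (crux stmt-CriticalPhenomena-4575), Sahi programme: **CELL CERTIFICATES V — SQUARE TERMS** (valid `4 × 4` forms on an
# embedded square: the NON-FLOW generators needed at front-profile-`2` pairs), the checker `checkCellSq` and its soundness

Support file (Sahi cell, seat `prim-sahi-p1`, generation 65; `--supports stmt-CriticalPhenomena-4575`); part V of the verified cell-certificate checker
(parts I–IV `…CellMirror`, `…CellAccum`, `…CellCheck`, `…CellTransport`).  No evaluation in this file; no `sorry`, standard axioms.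

WHY (gen65 NOTES; kit j345470/78/80/82/85).  With flow generators (points, cover differences, score differences) the cell LPs are INFEASIBLE at
every cell for `C₄` at front profiles `1222`, `2222` and for `C₆` at `121222`, `122222`, `222222` (and at the cells not anchored at the `11`-pair
for `111222`, `112222`): at a profile-`2` pair the coefficient vector `c` is negative below the slot and the `G ⊗ H` identity needs elements of
the dual cone `(K × K)*` that are not products of Hall generators.  The smallest such elements live on pairs of 2-dimensional faces: at `k = 4`,
arbitrary VALID `4 × 4` matrices on pairs of 2-faces (not only block-aligned ones) make every cell feasible (exact, denominators ≤ 2 digits).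
WHAT.  §1 `sqValid M` (nonnegative on the `25` pairs of nonempty up-sets of the square `0<1<3`, `0<2<3`), `sqForm`, ★ `sqForm_nonneg`: a valid
form is nonnegative at every pair of nonnegative value vectors that are monotone along the square — the four-case layer-cake decomposition
`φ = φ₀·1_{0123} + (φ₁−φ₀)·1_{123} + (φ₂−φ₁)·1_{23} + (φ₃−φ₂)·1_{3}` (`φ₁ ≤ φ₂`; mirror otherwise) exhibits it as a nonnegative
combination of the validity values.  §2 SQUARE TERMS `(P, Q, M) : SqTerm`: four row codes `P₀ ≤ P₁ ≤ P₃`, `P₀ ≤ P₂ ≤ P₃` (bitwise, `sqChainOK`),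
four column codes, a valid matrix (`sqOK`); their sixteen sparse rank-one entries `sqExpand` (accumulated by the part-II machinery, signs
allowed), the real triples `sqTriples`, ★ `ghEval_sqExpand`, `sum_sqTriples`, ★ `sqFormAt_nonneg` (an admissible square term is nonnegative at
all nonnegative monotone pairs — NO cell condition needed).  The checker with square terms and its soundness are in `…CellFaceCheck` (part VI). [this work]
-/

namespace Summit.CriticalPhenomena.PercolationContinuityZ3.Theorems.SahiThreeCopy

open Finset Function Literature.Combinatorics.Sahi2008
open scoped BigOperators

variable {k : ℕ}

/-! ### §1 Valid `4 × 4` forms on the square `0 < 1 < 3`, `0 < 2 < 3` (local index `u = u₀ + 2u₁`) -/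

/-- The five nonempty up-sets of the square, as member lists. [this work] -/
def sqUps : List (List ℕ) := [[3], [1, 3], [2, 3], [1, 2, 3], [0, 1, 2, 3]]

/-- `Σ_{u ∈ U, w ∈ T} M[4u + w]` for a row-major `4 × 4` integer matrix `M`. [this work] -/
def sqSum (M : List ℤ) (U T : List ℕ) : ℤ := (U.map fun u => (T.map fun w => M.getD (4 * u + w) 0).sum).sum

/-- VALIDITY of a square form: nonnegative on all `25` pairs of nonempty up-sets of the square. [this work] -/
def sqValid (M : List ℤ) : Bool := sqUps.all fun U => sqUps.all fun T => decide (0 ≤ sqSum M U T)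

/-- The bilinear form of `M` at local value vectors `φ, ψ : ℕ → ℝ` (indices `0..3`), written out. [this work] -/
noncomputable def sqForm (M : List ℤ) (φ ψ : ℕ → ℝ) : ℝ :=
  (M.getD 0 0 : ℝ) * (φ 0 * ψ 0) + (M.getD 1 0 : ℝ) * (φ 0 * ψ 1) + (M.getD 2 0 : ℝ) * (φ 0 * ψ 2) + (M.getD 3 0 : ℝ) * (φ 0 * ψ 3)
  + (M.getD 4 0 : ℝ) * (φ 1 * ψ 0) + (M.getD 5 0 : ℝ) * (φ 1 * ψ 1) + (M.getD 6 0 : ℝ) * (φ 1 * ψ 2) + (M.getD 7 0 : ℝ) * (φ 1 * ψ 3)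
  + (M.getD 8 0 : ℝ) * (φ 2 * ψ 0) + (M.getD 9 0 : ℝ) * (φ 2 * ψ 1) + (M.getD 10 0 : ℝ) * (φ 2 * ψ 2) + (M.getD 11 0 : ℝ) * (φ 2 * ψ 3)
  + (M.getD 12 0 : ℝ) * (φ 3 * ψ 0) + (M.getD 13 0 : ℝ) * (φ 3 * ψ 1) + (M.getD 14 0 : ℝ) * (φ 3 * ψ 2) + (M.getD 15 0 : ℝ) * (φ 3 * ψ 3)

/-- Unpacking validity (real casts of the 25 facts). [this work] -/
theorem sqValid_spec {M : List ℤ} (h : sqValid M = true) : ∀ U ∈ sqUps, ∀ T ∈ sqUps, (0 : ℝ) ≤ (sqSum M U T : ℝ) := by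
  intro U hU T hT
  unfold sqValid at h
  rw [List.all_eq_true] at h
  have h1 := h U hU
  rw [List.all_eq_true] at h1
  have h2 := h1 T hT
  rw [decide_eq_true_eq] at h2
  exact_mod_cast h2

/-- ★ **A valid square form is nonnegative on nonnegative pairs that are monotone along the square** (`φ₀ ≤ φ₁ ≤ φ₃`, `φ₀ ≤ φ₂ ≤ φ₃`):
by the layer-cake decomposition `φ = φ₀·1_{0123} + (φ₁−φ₀)·1_{123} + (φ₂−φ₁)·1_{23} + (φ₃−φ₂)·1_{3}` when `φ₁ ≤ φ₂` (and its mirror),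
the form is a nonnegative combination of the `25` validity values. [this work] -/
theorem sqForm_nonneg {M : List ℤ} (hM : sqValid M = true) (φ ψ : ℕ → ℝ)
    (hφ0 : 0 ≤ φ 0) (hφ01 : φ 0 ≤ φ 1) (hφ02 : φ 0 ≤ φ 2) (hφ13 : φ 1 ≤ φ 3) (hφ23 : φ 2 ≤ φ 3)
    (hψ0 : 0 ≤ ψ 0) (hψ01 : ψ 0 ≤ ψ 1) (hψ02 : ψ 0 ≤ ψ 2) (hψ13 : ψ 1 ≤ ψ 3) (hψ23 : ψ 2 ≤ ψ 3) :
    0 ≤ sqForm M φ ψ := by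
  have v := fun (U T : List ℕ) (hU : U ∈ sqUps) (hT : T ∈ sqUps) => sqValid_spec hM U hU T hT
  have m5 : [0,1,2,3] ∈ sqUps := by simp [sqUps]
  have m4 : [1,2,3] ∈ sqUps := by simp [sqUps]
  have m2 : [2,3] ∈ sqUps := by simp [sqUps]
  have m1 : [1,3] ∈ sqUps := by simp [sqUps]
  have m3 : [3] ∈ sqUps := by simp [sqUps]
  have a55 := v _ _ m5 m5; have a54 := v _ _ m5 m4; have a52 := v _ _ m5 m2; have a51 := v _ _ m5 m1; have a53 := v _ _ m5 m3
  have a45 := v _ _ m4 m5; have a44 := v _ _ m4 m4; have a42 := v _ _ m4 m2; have a41 := v _ _ m4 m1; have a43 := v _ _ m4 m3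
  have a25 := v _ _ m2 m5; have a24 := v _ _ m2 m4; have a22 := v _ _ m2 m2; have a21 := v _ _ m2 m1; have a23 := v _ _ m2 m3
  have a15 := v _ _ m1 m5; have a14 := v _ _ m1 m4; have a12 := v _ _ m1 m2; have a11 := v _ _ m1 m1; have a13 := v _ _ m1 m3
  have a35 := v _ _ m3 m5; have a34 := v _ _ m3 m4; have a32 := v _ _ m3 m2; have a31 := v _ _ m3 m1; have a33 := v _ _ m3 m3
  have p0 := hφ0; have q0 := hψ0
  have p1 := sub_nonneg.2 hφ01; have p2 := sub_nonneg.2 hφ02; have p13 := sub_nonneg.2 hφ13; have p23 := sub_nonneg.2 hφ23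
  have q1 := sub_nonneg.2 hψ01; have q2 := sub_nonneg.2 hψ02; have q13 := sub_nonneg.2 hψ13; have q23 := sub_nonneg.2 hψ23
  rcases le_total (φ 1) (φ 2) with hφ12 | hφ21 <;> rcases le_total (ψ 1) (ψ 2) with hψ12 | hψ21
  · have p12 := sub_nonneg.2 hφ12; have q12 := sub_nonneg.2 hψ12
    have key : sqForm M φ ψ = φ 0 * ψ 0 * (sqSum M [0,1,2,3] [0,1,2,3] : ℝ) + φ 0 * (ψ 1 - ψ 0) * (sqSum M [0,1,2,3] [1,2,3] : ℝ) +
        φ 0 * (ψ 2 - ψ 1) * (sqSum M [0,1,2,3] [2,3] : ℝ) + φ 0 * (ψ 3 - ψ 2) * (sqSum M [0,1,2,3] [3] : ℝ) +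
        (φ 1 - φ 0) * ψ 0 * (sqSum M [1,2,3] [0,1,2,3] : ℝ) + (φ 1 - φ 0) * (ψ 1 - ψ 0) * (sqSum M [1,2,3] [1,2,3] : ℝ) +
        (φ 1 - φ 0) * (ψ 2 - ψ 1) * (sqSum M [1,2,3] [2,3] : ℝ) + (φ 1 - φ 0) * (ψ 3 - ψ 2) * (sqSum M [1,2,3] [3] : ℝ) +
        (φ 2 - φ 1) * ψ 0 * (sqSum M [2,3] [0,1,2,3] : ℝ) + (φ 2 - φ 1) * (ψ 1 - ψ 0) * (sqSum M [2,3] [1,2,3] : ℝ) +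
        (φ 2 - φ 1) * (ψ 2 - ψ 1) * (sqSum M [2,3] [2,3] : ℝ) + (φ 2 - φ 1) * (ψ 3 - ψ 2) * (sqSum M [2,3] [3] : ℝ) +
        (φ 3 - φ 2) * ψ 0 * (sqSum M [3] [0,1,2,3] : ℝ) + (φ 3 - φ 2) * (ψ 1 - ψ 0) * (sqSum M [3] [1,2,3] : ℝ) +
        (φ 3 - φ 2) * (ψ 2 - ψ 1) * (sqSum M [3] [2,3] : ℝ) + (φ 3 - φ 2) * (ψ 3 - ψ 2) * (sqSum M [3] [3] : ℝ) := by
      simp only [sqForm, sqSum, List.map_cons, List.map_nil, List.sum_cons, List.sum_nil, add_zero, Int.cast_add]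
      norm_num only [Nat.reduceMul, Nat.reduceAdd]; ring
    rw [key]
    exact add_nonneg (add_nonneg (add_nonneg (add_nonneg (add_nonneg (add_nonneg (add_nonneg (add_nonneg (add_nonneg (add_nonneg (add_nonneg (add_nonneg (add_nonneg (add_nonneg (add_nonneg (mul_nonneg (mul_nonneg p0 q0) a55)
      (mul_nonneg (mul_nonneg p0 q1) a54)) (mul_nonneg (mul_nonneg p0 q12) a52)) (mul_nonneg (mul_nonneg p0 q23) a53))
      (mul_nonneg (mul_nonneg p1 q0) a45)) (mul_nonneg (mul_nonneg p1 q1) a44)) (mul_nonneg (mul_nonneg p1 q12) a42))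
      (mul_nonneg (mul_nonneg p1 q23) a43)) (mul_nonneg (mul_nonneg p12 q0) a25)) (mul_nonneg (mul_nonneg p12 q1) a24))
      (mul_nonneg (mul_nonneg p12 q12) a22)) (mul_nonneg (mul_nonneg p12 q23) a23)) (mul_nonneg (mul_nonneg p23 q0) a35))
      (mul_nonneg (mul_nonneg p23 q1) a34)) (mul_nonneg (mul_nonneg p23 q12) a32)) (mul_nonneg (mul_nonneg p23 q23) a33)
  · have p12 := sub_nonneg.2 hφ12; have q21 := sub_nonneg.2 hψ21
    have key : sqForm M φ ψ = φ 0 * ψ 0 * (sqSum M [0,1,2,3] [0,1,2,3] : ℝ) + φ 0 * (ψ 2 - ψ 0) * (sqSum M [0,1,2,3] [1,2,3] : ℝ) +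
        φ 0 * (ψ 1 - ψ 2) * (sqSum M [0,1,2,3] [1,3] : ℝ) + φ 0 * (ψ 3 - ψ 1) * (sqSum M [0,1,2,3] [3] : ℝ) +
        (φ 1 - φ 0) * ψ 0 * (sqSum M [1,2,3] [0,1,2,3] : ℝ) + (φ 1 - φ 0) * (ψ 2 - ψ 0) * (sqSum M [1,2,3] [1,2,3] : ℝ) +
        (φ 1 - φ 0) * (ψ 1 - ψ 2) * (sqSum M [1,2,3] [1,3] : ℝ) + (φ 1 - φ 0) * (ψ 3 - ψ 1) * (sqSum M [1,2,3] [3] : ℝ) +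
        (φ 2 - φ 1) * ψ 0 * (sqSum M [2,3] [0,1,2,3] : ℝ) + (φ 2 - φ 1) * (ψ 2 - ψ 0) * (sqSum M [2,3] [1,2,3] : ℝ) +
        (φ 2 - φ 1) * (ψ 1 - ψ 2) * (sqSum M [2,3] [1,3] : ℝ) + (φ 2 - φ 1) * (ψ 3 - ψ 1) * (sqSum M [2,3] [3] : ℝ) +
        (φ 3 - φ 2) * ψ 0 * (sqSum M [3] [0,1,2,3] : ℝ) + (φ 3 - φ 2) * (ψ 2 - ψ 0) * (sqSum M [3] [1,2,3] : ℝ) +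
        (φ 3 - φ 2) * (ψ 1 - ψ 2) * (sqSum M [3] [1,3] : ℝ) + (φ 3 - φ 2) * (ψ 3 - ψ 1) * (sqSum M [3] [3] : ℝ) := by
      simp only [sqForm, sqSum, List.map_cons, List.map_nil, List.sum_cons, List.sum_nil, add_zero, Int.cast_add]
      norm_num only [Nat.reduceMul, Nat.reduceAdd]; ring
    rw [key]
    exact add_nonneg (add_nonneg (add_nonneg (add_nonneg (add_nonneg (add_nonneg (add_nonneg (add_nonneg (add_nonneg (add_nonneg (add_nonneg (add_nonneg (add_nonneg (add_nonneg (add_nonneg (mul_nonneg (mul_nonneg p0 q0) a55)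
      (mul_nonneg (mul_nonneg p0 q2) a54)) (mul_nonneg (mul_nonneg p0 q21) a51)) (mul_nonneg (mul_nonneg p0 q13) a53))
      (mul_nonneg (mul_nonneg p1 q0) a45)) (mul_nonneg (mul_nonneg p1 q2) a44)) (mul_nonneg (mul_nonneg p1 q21) a41))
      (mul_nonneg (mul_nonneg p1 q13) a43)) (mul_nonneg (mul_nonneg p12 q0) a25)) (mul_nonneg (mul_nonneg p12 q2) a24))
      (mul_nonneg (mul_nonneg p12 q21) a21)) (mul_nonneg (mul_nonneg p12 q13) a23)) (mul_nonneg (mul_nonneg p23 q0) a35))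
      (mul_nonneg (mul_nonneg p23 q2) a34)) (mul_nonneg (mul_nonneg p23 q21) a31)) (mul_nonneg (mul_nonneg p23 q13) a33)
  · have p21 := sub_nonneg.2 hφ21; have q12 := sub_nonneg.2 hψ12
    have key : sqForm M φ ψ = φ 0 * ψ 0 * (sqSum M [0,1,2,3] [0,1,2,3] : ℝ) + φ 0 * (ψ 1 - ψ 0) * (sqSum M [0,1,2,3] [1,2,3] : ℝ) +
        φ 0 * (ψ 2 - ψ 1) * (sqSum M [0,1,2,3] [2,3] : ℝ) + φ 0 * (ψ 3 - ψ 2) * (sqSum M [0,1,2,3] [3] : ℝ) +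
        (φ 2 - φ 0) * ψ 0 * (sqSum M [1,2,3] [0,1,2,3] : ℝ) + (φ 2 - φ 0) * (ψ 1 - ψ 0) * (sqSum M [1,2,3] [1,2,3] : ℝ) +
        (φ 2 - φ 0) * (ψ 2 - ψ 1) * (sqSum M [1,2,3] [2,3] : ℝ) + (φ 2 - φ 0) * (ψ 3 - ψ 2) * (sqSum M [1,2,3] [3] : ℝ) +
        (φ 1 - φ 2) * ψ 0 * (sqSum M [1,3] [0,1,2,3] : ℝ) + (φ 1 - φ 2) * (ψ 1 - ψ 0) * (sqSum M [1,3] [1,2,3] : ℝ) +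
        (φ 1 - φ 2) * (ψ 2 - ψ 1) * (sqSum M [1,3] [2,3] : ℝ) + (φ 1 - φ 2) * (ψ 3 - ψ 2) * (sqSum M [1,3] [3] : ℝ) +
        (φ 3 - φ 1) * ψ 0 * (sqSum M [3] [0,1,2,3] : ℝ) + (φ 3 - φ 1) * (ψ 1 - ψ 0) * (sqSum M [3] [1,2,3] : ℝ) +
        (φ 3 - φ 1) * (ψ 2 - ψ 1) * (sqSum M [3] [2,3] : ℝ) + (φ 3 - φ 1) * (ψ 3 - ψ 2) * (sqSum M [3] [3] : ℝ) := by
      simp only [sqForm, sqSum, List.map_cons, List.map_nil, List.sum_cons, List.sum_nil, add_zero, Int.cast_add]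
      norm_num only [Nat.reduceMul, Nat.reduceAdd]; ring
    rw [key]
    exact add_nonneg (add_nonneg (add_nonneg (add_nonneg (add_nonneg (add_nonneg (add_nonneg (add_nonneg (add_nonneg (add_nonneg (add_nonneg (add_nonneg (add_nonneg (add_nonneg (add_nonneg (mul_nonneg (mul_nonneg p0 q0) a55)
      (mul_nonneg (mul_nonneg p0 q1) a54)) (mul_nonneg (mul_nonneg p0 q12) a52)) (mul_nonneg (mul_nonneg p0 q23) a53))
      (mul_nonneg (mul_nonneg p2 q0) a45)) (mul_nonneg (mul_nonneg p2 q1) a44)) (mul_nonneg (mul_nonneg p2 q12) a42))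
      (mul_nonneg (mul_nonneg p2 q23) a43)) (mul_nonneg (mul_nonneg p21 q0) a15)) (mul_nonneg (mul_nonneg p21 q1) a14))
      (mul_nonneg (mul_nonneg p21 q12) a12)) (mul_nonneg (mul_nonneg p21 q23) a13)) (mul_nonneg (mul_nonneg p13 q0) a35))
      (mul_nonneg (mul_nonneg p13 q1) a34)) (mul_nonneg (mul_nonneg p13 q12) a32)) (mul_nonneg (mul_nonneg p13 q23) a33)
  · have p21 := sub_nonneg.2 hφ21; have q21 := sub_nonneg.2 hψ21
    have key : sqForm M φ ψ = φ 0 * ψ 0 * (sqSum M [0,1,2,3] [0,1,2,3] : ℝ) + φ 0 * (ψ 2 - ψ 0) * (sqSum M [0,1,2,3] [1,2,3] : ℝ) +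
        φ 0 * (ψ 1 - ψ 2) * (sqSum M [0,1,2,3] [1,3] : ℝ) + φ 0 * (ψ 3 - ψ 1) * (sqSum M [0,1,2,3] [3] : ℝ) +
        (φ 2 - φ 0) * ψ 0 * (sqSum M [1,2,3] [0,1,2,3] : ℝ) + (φ 2 - φ 0) * (ψ 2 - ψ 0) * (sqSum M [1,2,3] [1,2,3] : ℝ) +
        (φ 2 - φ 0) * (ψ 1 - ψ 2) * (sqSum M [1,2,3] [1,3] : ℝ) + (φ 2 - φ 0) * (ψ 3 - ψ 1) * (sqSum M [1,2,3] [3] : ℝ) +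
        (φ 1 - φ 2) * ψ 0 * (sqSum M [1,3] [0,1,2,3] : ℝ) + (φ 1 - φ 2) * (ψ 2 - ψ 0) * (sqSum M [1,3] [1,2,3] : ℝ) +
        (φ 1 - φ 2) * (ψ 1 - ψ 2) * (sqSum M [1,3] [1,3] : ℝ) + (φ 1 - φ 2) * (ψ 3 - ψ 1) * (sqSum M [1,3] [3] : ℝ) +
        (φ 3 - φ 1) * ψ 0 * (sqSum M [3] [0,1,2,3] : ℝ) + (φ 3 - φ 1) * (ψ 2 - ψ 0) * (sqSum M [3] [1,2,3] : ℝ) +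
        (φ 3 - φ 1) * (ψ 1 - ψ 2) * (sqSum M [3] [1,3] : ℝ) + (φ 3 - φ 1) * (ψ 3 - ψ 1) * (sqSum M [3] [3] : ℝ) := by
      simp only [sqForm, sqSum, List.map_cons, List.map_nil, List.sum_cons, List.sum_nil, add_zero, Int.cast_add]
      norm_num only [Nat.reduceMul, Nat.reduceAdd]; ring
    rw [key]
    exact add_nonneg (add_nonneg (add_nonneg (add_nonneg (add_nonneg (add_nonneg (add_nonneg (add_nonneg (add_nonneg (add_nonneg (add_nonneg (add_nonneg (add_nonneg (add_nonneg (add_nonneg (mul_nonneg (mul_nonneg p0 q0) a55)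
      (mul_nonneg (mul_nonneg p0 q2) a54)) (mul_nonneg (mul_nonneg p0 q21) a51)) (mul_nonneg (mul_nonneg p0 q13) a53))
      (mul_nonneg (mul_nonneg p2 q0) a45)) (mul_nonneg (mul_nonneg p2 q2) a44)) (mul_nonneg (mul_nonneg p2 q21) a41))
      (mul_nonneg (mul_nonneg p2 q13) a43)) (mul_nonneg (mul_nonneg p21 q0) a15)) (mul_nonneg (mul_nonneg p21 q2) a14))
      (mul_nonneg (mul_nonneg p21 q21) a11)) (mul_nonneg (mul_nonneg p21 q13) a13)) (mul_nonneg (mul_nonneg p13 q0) a35))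
      (mul_nonneg (mul_nonneg p13 q2) a34)) (mul_nonneg (mul_nonneg p13 q21) a31)) (mul_nonneg (mul_nonneg p13 q13) a33)

/-! ### §2 Square terms in a cell certificate -/

/-- A SQUARE TERM `(P, Q, M)`: row point codes `P = [P₀,P₁,P₂,P₃]` with `P₀ ≤ P₁ ≤ P₃`, `P₀ ≤ P₂ ≤ P₃` (bitwise), column codes `Q`
likewise, and a row-major `4 × 4` integer matrix `M`; it stands for the bilinear form `Σ_{u,w} M[4u+w] φ(P_u) ψ(Q_w)`. [this work] -/
abbrev SqTerm := List ℕ × List ℕ × List ℤ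

/-- The square-chain condition on four codes (in range, `P₀|P₁ = P₁`, `P₀|P₂ = P₂`, `P₁|P₃ = P₃`, `P₂|P₃ = P₃`). [this work] -/
def sqChainOK (N : ℕ) (P : List ℕ) : Bool :=
  decide (P.getD 0 0 < N) && decide (P.getD 1 0 < N) && decide (P.getD 2 0 < N) && decide (P.getD 3 0 < N) &&
  (P.getD 0 0 ||| P.getD 1 0 == P.getD 1 0) && (P.getD 0 0 ||| P.getD 2 0 == P.getD 2 0) &&
  (P.getD 1 0 ||| P.getD 3 0 == P.getD 3 0) && (P.getD 2 0 ||| P.getD 3 0 == P.getD 3 0)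

/-- Admissibility of a square term: both chains in range and ordered, the matrix valid. [this work] -/
def sqOK (k : ℕ) (t : SqTerm) : Bool := sqChainOK (2 ^ k) t.1 && sqChainOK (2 ^ k) t.2.1 && sqValid t.2.2

/-- One rank-one entry of a square term (sparse form). [this work] -/
def sqEntry (t : SqTerm) (u w : ℕ) : STerm := ([(t.1.getD u 0, 1)], [(t.2.1.getD w 0, 1)], t.2.2.getD (4 * u + w) 0)

/-- The sixteen sparse rank-one entries of a square term. [this work] -/
def sqExpand (t : SqTerm) : List STerm :=
  [sqEntry t 0 0, sqEntry t 0 1, sqEntry t 0 2, sqEntry t 0 3, sqEntry t 1 0, sqEntry t 1 1, sqEntry t 1 2, sqEntry t 1 3,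
   sqEntry t 2 0, sqEntry t 2 1, sqEntry t 2 2, sqEntry t 2 3, sqEntry t 3 0, sqEntry t 3 1, sqEntry t 3 2, sqEntry t 3 3]

/-- All sparse entries of a list of square terms. [this work] -/
def sqExpandAll : List SqTerm → List STerm
  | [] => []
  | t :: S => sqExpand t ++ sqExpandAll S

/-- `ghEval` is additive over concatenation. [this work] -/
theorem ghEval_append : ∀ (T₁ T₂ : List STerm) (i j : ℕ), ghEval (T₁ ++ T₂) i j = ghEval T₁ i j + ghEval T₂ i j
  | [], T₂, i, j => by simp [ghEval]
  | t :: T₁, T₂, i, j => by rw [List.cons_append, ghEval, ghEval, ghEval_append T₁ T₂ i j]; ring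

/-- The value of one square term's sixteen entries at a pair of codes, as a real: `Σ_{u,w} M[4u+w]·[i = P_u]·[j = Q_w]`. [this work] -/
noncomputable def sqKer (t : SqTerm) (i j : ℕ) : ℝ := (ghEval (sqExpand t) i j : ℝ)

/-- The square form of a term at two level functions: `Σ_{u,w} M[4u+w] φ(P_u) ψ(Q_w)`. [this work] -/
noncomputable def sqFormAt (k : ℕ) (t : SqTerm) (φ ψ : Pt k → ℝ) : ℝ :=
  sqForm t.2.2 (fun u => φ (ptOfCode k (t.1.getD u 0))) (fun w => ψ (ptOfCode k (t.2.1.getD w 0)))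

/-- A one-entry sparse vector evaluated at the code of a level (plumbing). [this work] -/
theorem evalSparse_single {a : ℕ} (ha : a < 2 ^ k) (c : ℤ) (e : Pt k) :
    evalSparse [(a, c)] (codeOf k e) = if e = ptOfCode k a then c else 0 := by
  simp only [evalSparse_cons, evalSparse_nil, add_zero]
  exact if_congr (by rw [eq_comm]; exact codeOf_eq_iff k e ha) rfl rfl

/-- Codes of an admissible chain are in range (plumbing). [this work] -/
theorem sqChainOK_lt {N : ℕ} {P : List ℕ} (hP : sqChainOK N P = true) {u : ℕ} (hu : u < 4) : P.getD u 0 < N := by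
  unfold sqChainOK at hP
  simp only [Bool.and_eq_true, decide_eq_true_eq, beq_iff_eq] at hP
  obtain ⟨⟨⟨⟨⟨⟨⟨h0, h1⟩, h2⟩, h3⟩, -⟩, -⟩, -⟩, -⟩ := hP
  interval_cases u
  · exact h0
  · exact h1
  · exact h2
  · exact h3

/-- The four order relations of an admissible chain (plumbing). [this work] -/
theorem sqChainOK_le {N : ℕ} {P : List ℕ} (hP : sqChainOK N P = true) :
    ptOfCode k (P.getD 0 0) ≤ ptOfCode k (P.getD 1 0) ∧ ptOfCode k (P.getD 0 0) ≤ ptOfCode k (P.getD 2 0) ∧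
    ptOfCode k (P.getD 1 0) ≤ ptOfCode k (P.getD 3 0) ∧ ptOfCode k (P.getD 2 0) ≤ ptOfCode k (P.getD 3 0) := by
  unfold sqChainOK at hP
  simp only [Bool.and_eq_true, decide_eq_true_eq, beq_iff_eq] at hP
  obtain ⟨⟨⟨⟨-, h01⟩, h02⟩, h13⟩, h23⟩ := hP
  exact ⟨ptOfCode_le_of_lor h01, ptOfCode_le_of_lor h02, ptOfCode_le_of_lor h13, ptOfCode_le_of_lor h23⟩

/-- The point indicator of a code. [this work] -/
noncomputable def indPt (k a : ℕ) : Pt k → ℝ := fun e => if e = ptOfCode k a then 1 else 0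

/-- `Σ_e [e = a]·φ(e) = φ(a)` (plumbing). [this work] -/
theorem sum_indPt_mul (a : ℕ) (φ : Pt k → ℝ) : ∑ e, indPt k a e * φ e = φ (ptOfCode k a) := by
  unfold indPt; exact sum_ite_mul_eq' φ _

/-- One real rank-one triple of a square term. [this work] -/
noncomputable def sqTriple (k : ℕ) (t : SqTerm) (u w : ℕ) : (Pt k → ℝ) × (Pt k → ℝ) × ℝ :=
  (indPt k (t.1.getD u 0), indPt k (t.2.1.getD w 0), (t.2.2.getD (4 * u + w) 0 : ℝ))

/-- The sixteen real rank-one triples of a square term (same order as `sqExpand`). [this work] -/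
noncomputable def sqTriples (k : ℕ) (t : SqTerm) : List ((Pt k → ℝ) × (Pt k → ℝ) × ℝ) :=
  [sqTriple k t 0 0, sqTriple k t 0 1, sqTriple k t 0 2, sqTriple k t 0 3, sqTriple k t 1 0, sqTriple k t 1 1, sqTriple k t 1 2, sqTriple k t 1 3,
   sqTriple k t 2 0, sqTriple k t 2 1, sqTriple k t 2 2, sqTriple k t 2 3, sqTriple k t 3 0, sqTriple k t 3 1, sqTriple k t 3 2, sqTriple k t 3 3]

/-- All real triples of a list of square terms. [this work] -/
noncomputable def sqTriplesAll (k : ℕ) : List SqTerm → List ((Pt k → ℝ) × (Pt k → ℝ) × ℝ)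
  | [] => []
  | t :: S => sqTriples k t ++ sqTriplesAll k S

/-- One sparse entry evaluated at codes of levels = its real triple evaluated (plumbing). [this work] -/
theorem sqEntry_eval (t : SqTerm) (hP : sqChainOK (2 ^ k) t.1 = true) (hQ : sqChainOK (2 ^ k) t.2.1 = true)
    {u w : ℕ} (hu : u < 4) (hw : w < 4) (e e' : Pt k) :
    (((sqEntry t u w).2.2 * evalSparse (sqEntry t u w).1 (codeOf k e) * evalSparse (sqEntry t u w).2.1 (codeOf k e') : ℤ) : ℝ) =
      (sqTriple k t u w).2.2 * ((sqTriple k t u w).1 e * (sqTriple k t u w).2.1 e') := by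
  simp only [sqEntry, sqTriple, indPt]
  rw [evalSparse_single (sqChainOK_lt hP hu), evalSparse_single (sqChainOK_lt hQ hw)]
  push_cast
  split_ifs <;> simp

/-- ★ The integer kernel of a square term at codes of levels is the value of its real triples (plumbing). [this work] -/
theorem ghEval_sqExpand (t : SqTerm) (hP : sqChainOK (2 ^ k) t.1 = true) (hQ : sqChainOK (2 ^ k) t.2.1 = true) (e e' : Pt k) :
    (ghEval (sqExpand t) (codeOf k e) (codeOf k e') : ℝ) = ((sqTriples k t).map fun tr => tr.2.2 * (tr.1 e * tr.2.1 e')).sum := by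
  have E := fun u w (hu : u < 4) (hw : w < 4) => sqEntry_eval t hP hQ hu hw e e'
  simp only [sqExpand, sqTriples, ghEval, List.map_cons, List.map_nil, List.sum_cons, List.sum_nil, Int.cast_add, Int.cast_zero,
    E 0 0 (by norm_num) (by norm_num), E 0 1 (by norm_num) (by norm_num), E 0 2 (by norm_num) (by norm_num), E 0 3 (by norm_num) (by norm_num),
    E 1 0 (by norm_num) (by norm_num), E 1 1 (by norm_num) (by norm_num), E 1 2 (by norm_num) (by norm_num), E 1 3 (by norm_num) (by norm_num),
    E 2 0 (by norm_num) (by norm_num), E 2 1 (by norm_num) (by norm_num), E 2 2 (by norm_num) (by norm_num), E 2 3 (by norm_num) (by norm_num),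
    E 3 0 (by norm_num) (by norm_num), E 3 1 (by norm_num) (by norm_num), E 3 2 (by norm_num) (by norm_num), E 3 3 (by norm_num) (by norm_num)]

/-- ★ The real triples of a square term against `(φ, ψ)` sum to its square form at `(φ, ψ)` (plumbing). [this work] -/
theorem sum_sqTriples (t : SqTerm) (φ ψ : Pt k → ℝ) :
    ((sqTriples k t).map fun tr => tr.2.2 * ((∑ e, tr.1 e * φ e) * ∑ e', tr.2.1 e' * ψ e')).sum = sqFormAt k t φ ψ := by
  simp only [sqTriples, sqTriple, List.map_cons, List.map_nil, List.sum_cons, List.sum_nil, sum_indPt_mul, add_zero]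
  unfold sqFormAt sqForm
  norm_num only [Nat.reduceMul, Nat.reduceAdd]
  ring

/-- ★ An admissible square term is nonnegative at every pair of nonnegative monotone level functions. [this work] -/
theorem sqFormAt_nonneg {t : SqTerm} (ht : sqOK k t = true) {φ ψ : Pt k → ℝ} (hφ : ∀ e, 0 ≤ φ e) (hψ : ∀ e, 0 ≤ ψ e)
    (hφm : Monotone φ) (hψm : Monotone ψ) : 0 ≤ sqFormAt k t φ ψ := by
  unfold sqOK at ht
  simp only [Bool.and_eq_true] at ht
  obtain ⟨⟨hP, hQ⟩, hM⟩ := ht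
  obtain ⟨hP01, hP02, hP13, hP23⟩ := sqChainOK_le (k := k) hP
  obtain ⟨hQ01, hQ02, hQ13, hQ23⟩ := sqChainOK_le (k := k) hQ
  exact sqForm_nonneg hM _ _ (hφ _) (hφm hP01) (hφm hP02) (hφm hP13) (hφm hP23) (hψ _) (hψm hQ01) (hψm hQ02) (hψm hQ13) (hψm hQ23)

end Summit.CriticalPhenomena.PercolationContinuityZ3.Theorems.SahiThreeCopy
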